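import Literature.NumberTheory.LFunctions.RudnickSarnakNUnsmoothing
import Literature.NumberTheory.LFunctions.RudnickSarnakNRenormalise
import Literature.NumberTheory.LFunctions.RudnickSarnakNMatchings
import Literature.NumberTheory.LFunctions.RHConditionalFactsRudnickSarnakProofs
import HarnessLib

/-!
# Rudnick–Sarnak, Theorem 3.2 for `ζ`: discharge of `rudnick_sarnak_unrestricted`

Z. Rudnick, P. Sarnak, *Zeros of principal `L`-functions and random matrix theory*, Duke Math.
J. **81** (1996), 269–322, **Theorem 3.2** (p. 285) for `L = ζ` (`m = 1`): *assume the Riemann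
Hypothesis; then for every admissible `Φ` at level `n` the unrestricted sums of `f_Φ` over the first
`N(T)` normalised ordinates satisfy `C_n(f_Φ, T) ∼ N(T) ∫ Φ C_O`.* This is the named fact
`Literature.NumberTheory.LFunctions.rudnick_sarnak_unrestricted` (`RudnickSarnak.lean`), discharged
here as `rudnick_sarnak_unrestricted_holds` by assembling the `RudnickSarnakN*` series:

* the **front end** (files `RudnickSarnakNKernel` … `RudnickSarnakNMatchings`): the `t`-averaged
  Guinand–Weil explicit formula, the Montgomery–Vaughan mean value theorem, the diagonal prime
  combinatorics and the prime number theorem give, under RH, the asymptotics of the windowed sums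
  `W_Φ(T)/(T log T) → c_n ∫ Φ C_O` (`RudnickSarnakN.tendsto_zeroSideSum_div_rsPairing`,
  `c_n = (2π)⁻¹ ∫ κⁿ`; Rudnick–Sarnak's Theorem 3.1 in windowed form and (3.9));
* the **unsmoothing** (`RudnickSarnakN.Unsmooth.exists_norm_zeroSideSum_sub_le`, files
  `RudnickSarnakNCluster` … `RudnickSarnakNUnsmoothing`): `W_Φ(T) = (∫ κⁿ) S'_Φ(T) + o(T log T)` with
  `S'_Φ(T) = Σ_{m ∈ [0,N(T))ⁿ} f_Φ(Lγ_m/2π)` (pp. 302–303);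
* the **change of normalisation** (`RudnickSarnakN.Unsmooth.exists_norm_sharpN_sub_sharpL_le`,
  `RudnickSarnakN.Unsmooth.sharpN_eq`, file `RudnickSarnakNRenormalise`):
  `S'_Φ(T) = C_n(f_Φ, T) + o(T log T)` ((3.75)–(3.77));
* `N(T) ∼ (T/2π) log T` (Riemann–von Mangoldt, `RudnickSarnak.tendsto_zetaZeroCount_div_main`).

Hence `C_n(f_Φ, T)/N(T) → ∫ Φ C_O` (`RudnickSarnakN.tendsto_unrestrictedLevelSum_div`), i.e.
`RSUnrestrictedLimits` under RH. As a corollary the tree's conditional reduction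
`rudnick_sarnak_of_unrestricted` yields Rudnick–Sarnak's Theorem 1.2 for `ζ` (`rudnick_sarnak_holds`).

## References

* Z. Rudnick, P. Sarnak, *Zeros of principal `L`-functions and random matrix theory*, Duke Math.
  J. 81 (1996), 269–322: Thm. 3.1, Thm. 3.2 (p. 285), (3.9), (3.71)–(3.77), pp. 302–304; Thm. 1.2.
* H. L. Montgomery, *The pair correlation of zeros of the zeta function*, Proc. Sympos. Pure Math.
  24 (1973), 181–193 (the `t`-average of the explicit formula).
* E. C. Titchmarsh, *The Theory of the Riemann Zeta-Function* (1986), Thm. 9.4.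
-/

noncomputable section

open Complex Filter Set MeasureTheory Finset
open scoped Real Topology ContDiff

namespace Literature.NumberTheory.LFunctions

namespace RudnickSarnakN

variable {k : ℕ}

/-- `c_n = (2π)⁻¹ ∫ κⁿ`: `levelConst (k+1) = (2π)⁻¹ cLim k`. [folklore] -/
theorem levelConst_eq (k : ℕ) : levelConst (k + 1) = (2 * π)⁻¹ * Unsmooth.cLim k := rfl

/-- An `o(T log T)` bound in `ε`-form gives a vanishing quotient. [folklore] -/
theorem tendsto_div_mul_log_of_eventually_le {F : ℝ → ℂ}
    (h : ∀ ε : ℝ, 0 < ε → ∀ᶠ T : ℝ in atTop, ‖F T‖ ≤ ε * (T * Real.log T)) :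
    Tendsto (fun T : ℝ ↦ F T / ((T : ℂ) * (Real.log T : ℂ))) atTop (𝓝 0) := by
  rw [Metric.tendsto_nhds]
  intro ε hε
  filter_upwards [h (ε / 2) (by positivity), eventually_gt_atTop (1 : ℝ)] with T hT hT1
  have hL : 0 < Real.log T := Real.log_pos hT1
  have hT0 : 0 < T := by linarith
  have hTL : 0 < T * Real.log T := by positivity
  rw [dist_zero_right, norm_div, norm_mul, Complex.norm_real, Complex.norm_real, Real.norm_of_nonneg hT0.le,
    Real.norm_of_nonneg hL.le, div_lt_iff₀ hTL]
  calc ‖F T‖ ≤ ε / 2 * (T * Real.log T) := hT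
    _ < ε * (T * Real.log T) := by nlinarith

/-- `N(T)/(T log T) → 1/2π`. [cite: Titchmarsh1986, Thm. 9.4] -/
theorem tendsto_zetaZeroCount_div_mul_log :
    Tendsto (fun T : ℝ ↦ (zetaZeroCount T : ℝ) / (T * Real.log T)) atTop (𝓝 (1 / (2 * π))) := by
  have h := RudnickSarnak.tendsto_zetaZeroCount_div_main.mul_const (1 / (2 * π))
  rw [one_mul] at h
  refine h.congr' ?_
  filter_upwards [eventually_gt_atTop (1 : ℝ)] with T hT
  have hL : Real.log T ≠ 0 := (Real.log_pos hT).ne'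
  have hT0 : T ≠ 0 := by positivity
  field_simp

/-- **Theorem 3.2 for `ζ` at level `n = k + 1`** (Rudnick–Sarnak 1996, p. 285; RH): for an
admissible `Φ`, `C_n(f_Φ, T)/N(T) → ∫ Φ C_O`. [cite: RudnickSarnak1996, Thm. 3.2] -/
theorem tendsto_unrestrictedLevelSum_div (hRH : RiemannHypothesis) {Φ : (Fin (k + 1) → ℝ) → ℂ}
    (hΦ : IsRSAdmissiblePhi k Φ) :
    Tendsto (fun T : ℝ ↦ unrestrictedLevelSum (k + 1) (rsPhiTest Φ) (zetaZeroCount T) / (zetaZeroCount T : ℂ))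
      atTop (𝓝 (rsPairingFunctional (k + 1) Φ)) := by
  have hd : ContDiff ℝ ∞ Φ := hΦ.contDiff
  have hs : HasCompactSupport Φ := hΦ.hasCompactSupport
  set Λ : ℂ := rsPairingFunctional (k + 1) Φ with hΛ
  set c : ℝ := Unsmooth.cLim k with hc
  have hc0 : 0 < c := Unsmooth.cLim_pos k
  set W : ℝ → ℂ := fun T ↦ zeroSideSum Φ T
  set S : ℝ → ℂ := fun T ↦ Unsmooth.sharpL Φ T
  set Cn : ℝ → ℂ := fun T ↦ unrestrictedLevelSum (k + 1) (rsPhiTest Φ) (zetaZeroCount T)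
  set D : ℝ → ℂ := fun T ↦ (T : ℂ) * (Real.log T : ℂ)
  -- (1) the front end
  have h1 : Tendsto (fun T ↦ W T / D T) atTop (𝓝 ((levelConst (k + 1) : ℂ) * Λ)) :=
    tendsto_zeroSideSum_div_rsPairing hRH hΦ
  -- (2) unsmoothing
  have h2 : Tendsto (fun T ↦ (W T - (c : ℂ) * S T) / D T) atTop (𝓝 0) := by
    refine tendsto_div_mul_log_of_eventually_le fun ε hε ↦ ?_
    obtain ⟨T₀, hT₀⟩ := Unsmooth.exists_norm_zeroSideSum_sub_le hRH hd hs hε (k := k)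
    filter_upwards [eventually_ge_atTop T₀] with T hT
    have := hT₀ T hT
    rwa [mul_assoc] at this
  -- (3) the change of normalisation
  have h3 : Tendsto (fun T ↦ (S T - Cn T) / D T) atTop (𝓝 0) := by
    refine tendsto_div_mul_log_of_eventually_le fun ε hε ↦ ?_
    obtain ⟨T₀, hT₀⟩ := Unsmooth.exists_norm_sharpN_sub_sharpL_le hRH hd hs hε (k := k)
    filter_upwards [eventually_ge_atTop T₀] with T hT
    have h := hT₀ T hT
    rw [← Unsmooth.sharpN_eq] at h
    simp only [S, Cn]
    rw [norm_sub_rev, ← mul_assoc]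
    exact h
  -- (4) `Cn/D → Λ/(2π)`
  have h4 : Tendsto (fun T ↦ Cn T / D T) atTop (𝓝 (Λ / (2 * π))) := by
    -- `c S / D → levelConst Λ`
    have hA : Tendsto (fun T ↦ (c : ℂ) * S T / D T) atTop (𝓝 ((levelConst (k + 1) : ℂ) * Λ)) := by
      have := h1.sub h2
      rw [sub_zero] at this
      refine this.congr' (Eventually.of_forall fun T ↦ ?_)
      simp only; ring
    -- `S / D → levelConst Λ / c = Λ/(2π)`
    have hB : Tendsto (fun T ↦ S T / D T) atTop (𝓝 (Λ / (2 * π))) := by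
      have := hA.const_mul ((c : ℂ)⁻¹)
      have hcne : (c : ℂ) ≠ 0 := Complex.ofReal_ne_zero.2 hc0.ne'
      have e : (c : ℂ)⁻¹ * ((levelConst (k + 1) : ℂ) * Λ) = Λ / (2 * π) := by
        rw [levelConst_eq, ← hc]
        push_cast
        field_simp
      rw [e] at this
      refine this.congr' (Eventually.of_forall fun T ↦ ?_)
      simp only
      field_simp
    have := hB.sub h3
    rw [sub_zero] at this
    refine this.congr' (Eventually.of_forall fun T ↦ ?_)
    simp only; ring
  -- (5) divide by `N(T)/D → 1/(2π)`
  have h5 : Tendsto (fun T ↦ ((zetaZeroCount T : ℝ) : ℂ) / D T) atTop (𝓝 (((1 / (2 * π) : ℝ) : ℂ))) := by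
    have h := (Complex.continuous_ofReal.tendsto _).comp tendsto_zetaZeroCount_div_mul_log
    refine h.congr' (Eventually.of_forall fun T ↦ ?_)
    simp only [Function.comp, D]
    push_cast
    rfl
  have hlim : Λ / (2 * π) / (((1 / (2 * π) : ℝ) : ℂ)) = Λ := by
    push_cast
    field_simp
  have h6 := h4.div h5 (by
    rw [Complex.ofReal_ne_zero]; positivity)
  rw [hlim] at h6
  refine h6.congr' ?_
  filter_upwards [eventually_gt_atTop (1 : ℝ)] with T hT
  have hD : D T ≠ 0 := by
    simp only [D]
    have hL : Real.log T ≠ 0 := (Real.log_pos hT).ne'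
    have hT0 : (T : ℂ) ≠ 0 := Complex.ofReal_ne_zero.2 (by positivity)
    exact mul_ne_zero hT0 (Complex.ofReal_ne_zero.2 hL)
  simp only [Pi.div_apply, Cn]
  rw [div_div_div_cancel_right₀ hD]
  norm_cast

/-- **`RSUnrestrictedLimits` under RH** (all levels). [cite: RudnickSarnak1996, Thm. 3.2] -/
theorem rsUnrestrictedLimits_of_rh (hRH : RiemannHypothesis) : RSUnrestrictedLimits :=
  fun hΦ ↦ tendsto_unrestrictedLevelSum_div hRH hΦ

end RudnickSarnakN

/-- **Discharge of `rudnick_sarnak_unrestricted`** (Rudnick–Sarnak 1996, **Theorem 3.2** for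
`L = ζ`, `m = 1`, p. 285): assuming the Riemann Hypothesis, for every level `n = k + 1` and every
admissible `Φ`, `C_n(f_Φ, T)/N(T) → ∫ Φ C_O`. Proof: the explicit formula with Montgomery's
`t`-average in every slot (front end, `RudnickSarnakN.tendsto_zeroSideSum_div_rsPairing`), the
unsmoothing of the window (`RudnickSarnakN.Unsmooth.exists_norm_zeroSideSum_sub_le`), the change of
normalisation `Lγ/2π ↦ γ̃` (`RudnickSarnakN.Unsmooth.exists_norm_sharpN_sub_sharpL_le`) and
`N(T) ∼ (T/2π) log T`. [cite: RudnickSarnak1996, Thm. 3.2 (p. 285)] -/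
theorem rudnick_sarnak_unrestricted_holds : rudnick_sarnak_unrestricted :=
  fun hRH ↦ RudnickSarnakN.rsUnrestrictedLimits_of_rh hRH

/-- **Rudnick–Sarnak's Theorem 1.2 for `ζ`** (`rudnick_sarnak`, rh.S32), now unconditional on any
named fact: Theorem 3.2 (`rudnick_sarnak_unrestricted_holds`) and the proved §4 reduction
(`rudnick_sarnak_of_unrestricted`). [cite: RudnickSarnak1996, Thm. 1.2, Thm. 3.2, §4] -/
theorem rudnick_sarnak_holds : rudnick_sarnak :=
  rudnick_sarnak_of_unrestricted rudnick_sarnak_unrestricted_holds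

end Literature.NumberTheory.LFunctions

end
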